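import Mathlib.Analysis.Polynomial.MahlerMeasure
import HarnessLib

/-!
# Roy's small value estimate for `𝔾ₐ × 𝔾ₘ` — suprema of products on convex bodies ([LR] Prop. 3.7 substitute)

Topic `Literature/NumberTheory/Transcendental`. Part of the formalisation of the proof of Roy 2013,
Theorem 1.1 (named fact `roy2013_thm_1_1`, `RoySmallValueEstimates.lean`). Source: D. Roy,
*A small value estimate for `𝔾ₐ × 𝔾ₘ`*, Mathematika 59 (2013) 333–363 = arXiv:1301.0663, §2
(p. 7 of the arXiv text), proof of Proposition 2.3:

> As this is a factorization of `F` into a product of `deg(Z)` linear forms on `ℂ[X]_D` [...],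
> Proposition 3.7 (i) of [LR] gives
> `| h_𝒞(Z) − log|a| − Σ_α log sup{|P(α)| ; P ∈ 𝒞} | ≤ 2 log(m+1) D deg(Z)`.

Roy's convex bodies (§2, p. 6) are the subsets `𝒞` of `ℂ[X]_D` with `λP + μQ ∈ 𝒞` whenever
`P, Q ∈ 𝒞` and `|λ| + |μ| ≤ 1`. We prove the non-trivial half of the comparison between the
supremum of a product of homogeneous polynomial maps on such a set and the product of the suprema,
with our own (explicit, slightly weaker) constants, by an argument independent of [LR]: restrict to
the complex line `z ↦ ((1+z)P + (1−z)Q)/4`, which stays in `𝒞` for `|z| = 1`, and use the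
multiplicativity of the Mahler measure (Mathlib) together with `|f(1)| ≤ 2^{deg f} M(f)` and
`M(fg) ≤ sup_{|z|=1} |fg|`:

* `norm_mul_norm_le_of_line`: `‖F P‖ ‖G Q‖ ≤ 4^{a+b} sup_𝒞 |FG|` for `P, Q ∈ 𝒞`;
* `prod_norm_le_of_prod_bound`: for `n ≤ 2^k` linear functionals `ℓᵢ` and points `Pᵢ ∈ 𝒞`,
  `∏ ‖ℓᵢ Pᵢ‖ ≤ 4^{k 2^k} sup_𝒞 |∏ ℓᵢ|` (binary splitting; loss `exp(O(n log n))`, which is what §6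
  of the paper can afford).

Everything here is proved from Mathlib; no new definitions, no named facts.

## References

* [Roy2013] D. Roy, *A small value estimate for 𝔾ₐ × 𝔾ₘ*, Mathematika 59 (2013), 333–363
  (arXiv:1301.0663), §2, Proposition 2.3 and its proof.
* [LR] M. Laurent, D. Roy, *Criteria of algebraic independence with multiplicities and
  approximation by hypersurfaces*, J. reine angew. Math. 536 (2001), 65–114, Proposition 3.7.
-/

noncomputable section

open Polynomial Finset

namespace Literature.NumberTheory.Transcendental

namespace Roy2013

/-! ### Two facts on the Mahler measure -/

/-- `|p(z)| ≤ 2^{deg p} M(p)` for `|z| ≤ 1` (from `|coeff_k| ≤ binom(deg, k) M(p)`). [folklore] -/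
theorem norm_eval_le_two_pow_mul_mahlerMeasure (p : ℂ[X]) {z : ℂ} (hz : ‖z‖ ≤ 1) :
    ‖p.eval z‖ ≤ 2 ^ p.natDegree * p.mahlerMeasure := by
  rw [eval_eq_sum_range]
  calc ‖∑ i ∈ range (p.natDegree + 1), p.coeff i * z ^ i‖
      ≤ ∑ i ∈ range (p.natDegree + 1), ‖p.coeff i‖ := norm_sum_le_of_le _ fun i _ => by
        rw [norm_mul, norm_pow]
        exact mul_le_of_le_one_right (norm_nonneg _) (pow_le_one₀ (norm_nonneg _) hz)
    _ ≤ ∑ i ∈ range (p.natDegree + 1), (p.natDegree.choose i : ℝ) * p.mahlerMeasure :=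
        sum_le_sum fun i _ => norm_coeff_le_choose_mul_mahlerMeasure i p
    _ = 2 ^ p.natDegree * p.mahlerMeasure := by
        rw [← sum_mul, ← Nat.cast_sum, Nat.sum_range_choose]; norm_cast

/-- `M(p) ≤ sup_{|z|=1} |p(z)|`. [folklore] -/
theorem mahlerMeasure_le_of_sphere (p : ℂ[X]) {B : ℝ} (hB : 0 ≤ B)
    (h : ∀ z ∈ Metric.sphere (0 : ℂ) 1, ‖p.eval z‖ ≤ B) : p.mahlerMeasure ≤ B := by
  by_cases hp : p = 0
  · rw [hp, mahlerMeasure_zero]; exact hB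
  refine le_of_forall_pos_le_add fun ε hε => ?_
  have hBε : 0 < B + ε := by linarith
  set q : ℂ[X] := C (((B + ε : ℝ) : ℂ)⁻¹) * p with hq
  have hq0 : q ≠ 0 := mul_ne_zero (by
    rw [Ne, C_eq_zero, inv_eq_zero]; exact_mod_cast hBε.ne') hp
  have hle : q.logMahlerMeasure ≤ 0 := by
    rw [logMahlerMeasure_def]
    refine Real.circleAverage_mono_on_of_le_circle
      ((circleIntegrable_def _ 0 1).mpr (intervalIntegrable_mahlerMeasure q)) fun z hz => ?_
    rw [abs_one] at hz
    have hzB := h z hz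
    have hqz : ‖q.eval z‖ ≤ 1 := by
      rw [hq, eval_mul, eval_C, norm_mul, norm_inv, Complex.norm_of_nonneg hBε.le,
        inv_mul_le_iff₀ hBε, mul_one]
      exact hzB.trans (by linarith)
    exact Real.log_nonpos (norm_nonneg _) hqz
  have hMq : q.mahlerMeasure ≤ 1 := by
    rw [mahlerMeasure, if_pos hq0]; exact Real.exp_le_one_iff.mpr hle
  rw [hq, mahlerMeasure_mul, mahlerMeasure_const, norm_inv, Complex.norm_of_nonneg hBε.le,
    inv_mul_le_iff₀ hBε, mul_one] at hMq
  exact hMq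

/-! ### Two factors -/

/-- **Suprema of products on a balanced convex set, two factors.** Let `K` satisfy
`aP + bQ ∈ K` for `P, Q ∈ K`, `|a| + |b| ≤ 1`; let `F, G` be homogeneous of degrees `a, b` and
polynomial along complex lines. If `|FG| ≤ B` on `K` then `‖F P‖ ‖G Q‖ ≤ 4^{a+b} B` for all
`P, Q ∈ K` (we write `4^{a+b}` as `2^{2(a+b)}`).
[cite: Roy2013, §2, proof of Proposition 2.3 (via [LR] Prop. 3.7); independent proof] -/
theorem norm_mul_norm_le_of_line {E : Type*} [AddCommGroup E] [Module ℂ E] {K : Set E}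
    (hK : ∀ P ∈ K, ∀ Q ∈ K, ∀ a b : ℂ, ‖a‖ + ‖b‖ ≤ 1 → a • P + b • Q ∈ K)
    {F G : E → ℂ} {a b : ℕ}
    (hFh : ∀ (t : ℂ) (P : E), F (t • P) = t ^ a * F P)
    (hGh : ∀ (t : ℂ) (P : E), G (t • P) = t ^ b * G P)
    (hFp : ∀ P Q : E, ∃ p : ℂ[X], p.natDegree ≤ a ∧ ∀ z : ℂ, F (P + z • Q) = p.eval z)
    (hGp : ∀ P Q : E, ∃ q : ℂ[X], q.natDegree ≤ b ∧ ∀ z : ℂ, G (P + z • Q) = q.eval z)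
    {B : ℝ} (hB : ∀ R ∈ K, ‖F R * G R‖ ≤ B) {P Q : E} (hP : P ∈ K) (hQ : Q ∈ K) :
    ‖F P‖ * ‖G Q‖ ≤ 2 ^ (2 * (a + b)) * B := by
  have hB0 : 0 ≤ B := (norm_nonneg _).trans (hB P hP)
  set P₀ : E := (1 / 4 : ℂ) • (P + Q) with hP₀
  set Q₀ : E := (1 / 4 : ℂ) • (P - Q) with hQ₀
  obtain ⟨f, hfdeg, hf⟩ := hFp P₀ Q₀
  obtain ⟨g, hgdeg, hg⟩ := hGp P₀ Q₀
  -- the line stays in `K` over the unit circle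
  have hmem : ∀ z : ℂ, ‖z‖ = 1 → P₀ + z • Q₀ ∈ K := by
    intro z hz
    have h := hK P hP Q hQ ((1 + z) / 4) ((1 - z) / 4) (by
      calc ‖(1 + z) / 4‖ + ‖(1 - z) / 4‖ = (‖1 + z‖ + ‖1 - z‖) / 4 := by
            rw [norm_div, norm_div]; norm_num; ring
        _ ≤ ((‖(1 : ℂ)‖ + ‖z‖) + (‖(1 : ℂ)‖ + ‖z‖)) / 4 := by
            gcongr
            · exact norm_add_le _ _
            · exact norm_sub_le _ _
        _ = 1 := by rw [norm_one, hz]; norm_num)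
    have he : P₀ + z • Q₀ = ((1 + z) / 4) • P + ((1 - z) / 4) • Q := by
      rw [hP₀, hQ₀]; module
    rwa [he]
  have hsphere : ∀ z ∈ Metric.sphere (0 : ℂ) 1, ‖(f * g).eval z‖ ≤ B := by
    intro z hz
    rw [mem_sphere_zero_iff_norm] at hz
    rw [eval_mul, ← hf, ← hg]
    exact hB _ (hmem z hz)
  have hM : (f * g).mahlerMeasure ≤ B := mahlerMeasure_le_of_sphere _ hB0 hsphere
  -- values at `z = 1` and `z = -1`
  have hFP : F P = 2 ^ a * f.eval 1 := by
    have h1 : P₀ + (1 : ℂ) • Q₀ = (1 / 2 : ℂ) • P := by rw [hP₀, hQ₀]; module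
    have h := hf 1
    rw [h1, hFh] at h
    rw [← h, ← mul_assoc, ← mul_pow]; norm_num
  have hGQ : G Q = 2 ^ b * g.eval (-1) := by
    have h1 : P₀ + (-1 : ℂ) • Q₀ = (1 / 2 : ℂ) • Q := by rw [hP₀, hQ₀]; module
    have h := hg (-1)
    rw [h1, hGh] at h
    rw [← h, ← mul_assoc, ← mul_pow]; norm_num
  have hf1 : ‖f.eval 1‖ ≤ 2 ^ a * f.mahlerMeasure :=
    (norm_eval_le_two_pow_mul_mahlerMeasure f (by simp)).trans
      (mul_le_mul_of_nonneg_right (pow_le_pow_right₀ one_le_two hfdeg) (mahlerMeasure_nonneg _))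
  have hg1 : ‖g.eval (-1)‖ ≤ 2 ^ b * g.mahlerMeasure :=
    (norm_eval_le_two_pow_mul_mahlerMeasure g (by simp)).trans
      (mul_le_mul_of_nonneg_right (pow_le_pow_right₀ one_le_two hgdeg) (mahlerMeasure_nonneg _))
  rw [hFP, hGQ, norm_mul, norm_mul, Complex.norm_pow, Complex.norm_pow, Complex.norm_ofNat]
  calc 2 ^ a * ‖f.eval 1‖ * (2 ^ b * ‖g.eval (-1)‖)
      ≤ 2 ^ a * (2 ^ a * f.mahlerMeasure) * (2 ^ b * (2 ^ b * g.mahlerMeasure)) :=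
        mul_le_mul (mul_le_mul_of_nonneg_left hf1 (by positivity))
          (mul_le_mul_of_nonneg_left hg1 (by positivity)) (by positivity)
          (mul_nonneg (by positivity) (mul_nonneg (by positivity) (mahlerMeasure_nonneg _)))
    _ = 2 ^ (2 * (a + b)) * (f * g).mahlerMeasure := by
        rw [mahlerMeasure_mul]; ring
    _ ≤ 2 ^ (2 * (a + b)) * B := mul_le_mul_of_nonneg_left hM (by positivity)

/-! ### Products of linear functionals -/

/-- Products of linear functionals are homogeneous. [folklore] -/
theorem list_prod_map_smul {E : Type*} [AddCommGroup E] [Module ℂ E]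
    (l : List ((E →ₗ[ℂ] ℂ) × E)) (t : ℂ) (R : E) :
    (l.map fun x => x.1 (t • R)).prod = t ^ l.length * (l.map fun x => x.1 R).prod := by
  induction l with
  | nil => simp
  | cons x l ih =>
    rw [List.map_cons, List.map_cons, List.prod_cons, List.prod_cons, ih, List.length_cons,
      map_smul, smul_eq_mul]
    ring

/-- Products of linear functionals are polynomial along lines. [folklore] -/
theorem list_prod_map_line {E : Type*} [AddCommGroup E] [Module ℂ E]
    (l : List ((E →ₗ[ℂ] ℂ) × E)) (P Q : E) :
    ∃ p : ℂ[X], p.natDegree ≤ l.length ∧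
      ∀ z : ℂ, (l.map fun x => x.1 (P + z • Q)).prod = p.eval z := by
  refine ⟨(l.map fun x => C (x.1 P) + C (x.1 Q) * Polynomial.X).prod, ?_, fun z => ?_⟩
  · refine (natDegree_list_prod_le _).trans ?_
    rw [List.map_map]
    refine (List.sum_le_card_nsmul _ 1 ?_).trans (by simp)
    intro n hn
    rw [List.mem_map] at hn
    obtain ⟨x, -, rfl⟩ := hn
    refine (natDegree_add_le _ _).trans (max_le (by simp) ((natDegree_C_mul_le _ _).trans ?_))
    exact natDegree_X_le
  · rw [eval_list_prod, List.map_map]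
    congr 1
    exact List.map_congr_left fun x _ => by
      simp only [Function.comp_apply, eval_add, eval_mul, eval_C, eval_X, map_add, map_smul,
        smul_eq_mul]
      ring

/-- **Suprema of products on a balanced convex set, `n ≤ 2^k` linear factors.** If
`|∏ᵢ ℓᵢ| ≤ B` on `K` (balanced convex, non-empty) then `∏ᵢ ‖ℓᵢ(Pᵢ)‖ ≤ 4^{k·2^k} B` for any points
`Pᵢ ∈ K` (written `2^{2k2^k}`); in particular `∏ᵢ sup_K |ℓᵢ| ≤ 4^{k·2^k} sup_K |∏ᵢ ℓᵢ|`, a loss of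
`exp(O(n log n))`.
[cite: Roy2013, §2, proof of Proposition 2.3 (via [LR] Prop. 3.7 (i)); independent proof] -/
theorem prod_norm_le_of_prod_bound {E : Type*} [AddCommGroup E] [Module ℂ E] {K : Set E}
    (hK : ∀ P ∈ K, ∀ Q ∈ K, ∀ a b : ℂ, ‖a‖ + ‖b‖ ≤ 1 → a • P + b • Q ∈ K) (hKne : K.Nonempty)
    (k : ℕ) : ∀ (l : List ((E →ₗ[ℂ] ℂ) × E)), l.length ≤ 2 ^ k → (∀ x ∈ l, x.2 ∈ K) →
      ∀ {B : ℝ}, (∀ R ∈ K, ‖(l.map fun x => x.1 R).prod‖ ≤ B) →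
        (l.map fun x => ‖x.1 x.2‖).prod ≤ 2 ^ (2 * k * 2 ^ k) * B := by
  induction k with
  | zero =>
    intro l hl hlK B hB
    obtain ⟨R₀, hR₀⟩ := hKne
    match l, hl, hlK, hB with
    | [], _, _, hB => simpa using hB R₀ hR₀
    | [x], _, hlK, hB =>
      have h := hB x.2 (hlK x (by simp))
      simpa using h
  | succ k ih =>
    intro l hl hlK B hB
    have hB0 : 0 ≤ B := by
      obtain ⟨R₀, hR₀⟩ := hKne; exact (norm_nonneg _).trans (hB R₀ hR₀)
    set l₁ := l.take (2 ^ k) with hl₁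
    set l₂ := l.drop (2 ^ k) with hl₂
    have hl₁₂ : l = l₁ ++ l₂ := (List.take_append_drop _ _).symm
    have hlen₁ : l₁.length ≤ 2 ^ k := by rw [hl₁, List.length_take]; exact min_le_left _ _
    have hlen₂ : l₂.length ≤ 2 ^ k := by
      rw [hl₂, List.length_drop, pow_succ] at *; omega
    have hl₁K : ∀ x ∈ l₁, x.2 ∈ K := fun x hx => hlK x (List.mem_of_mem_take hx)
    have hl₂K : ∀ x ∈ l₂, x.2 ∈ K := fun x hx => hlK x (List.mem_of_mem_drop hx)
    -- the two-factor inequality for `F = ∏_{l₁}`, `G = ∏_{l₂}`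
    have htwo : ∀ P' ∈ K, ∀ Q' ∈ K,
        ‖(l₁.map fun x => x.1 P').prod‖ * ‖(l₂.map fun x => x.1 Q').prod‖ ≤
          2 ^ (2 * 2 ^ (k + 1)) * B := by
      intro P' hP' Q' hQ'
      refine (norm_mul_norm_le_of_line hK (F := fun R => (l₁.map fun x => x.1 R).prod)
        (G := fun R => (l₂.map fun x => x.1 R).prod) (list_prod_map_smul l₁)
        (list_prod_map_smul l₂) (list_prod_map_line l₁) (list_prod_map_line l₂)
        (B := B) (fun R hR => ?_) hP' hQ').trans ?_
      · rw [← List.prod_append, ← List.map_append, ← hl₁₂]; exact hB R hR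
      · refine mul_le_mul_of_nonneg_right (pow_le_pow_right₀ (by norm_num) ?_) hB0
        rw [← List.length_append, ← hl₁₂]; exact Nat.mul_le_mul_left 2 hl
    rw [hl₁₂, List.map_append, List.prod_append]
    -- if the first product of values vanishes there is nothing to prove
    rcases eq_or_lt_of_le (List.prod_nonneg (s := l₁.map fun x => ‖x.1 x.2‖)
      (fun r hr => by
        rw [List.mem_map] at hr; obtain ⟨x, -, rfl⟩ := hr; exact norm_nonneg _)) with h0 | hpos
    · rw [← h0, zero_mul]; positivity
    -- bound for `F` on `K`, from any `Q'` with `G Q' ≠ 0`; then bound for `G`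
    have hG : ∀ Q' ∈ K, ‖(l₂.map fun x => x.1 Q').prod‖ ≤
        2 ^ (2 * k * 2 ^ k) * (2 ^ (2 * 2 ^ (k + 1)) * B) / (l₁.map fun x => ‖x.1 x.2‖).prod := by
      intro Q' hQ'
      rw [le_div_iff₀ hpos]
      rcases eq_or_lt_of_le (norm_nonneg ((l₂.map fun x => x.1 Q').prod)) with hG0 | hGpos
      · rw [← hG0, zero_mul]; positivity
      have hF := ih l₁ hlen₁ hl₁K (B := 2 ^ (2 * 2 ^ (k + 1)) * B / ‖(l₂.map fun x => x.1 Q').prod‖)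
        (fun R hR => by rw [le_div_iff₀ hGpos]; exact htwo R hR Q' hQ')
      rw [mul_div_assoc'] at hF
      rw [mul_comm]
      exact (le_div_iff₀ hGpos).mp hF
    have h₂ := ih l₂ hlen₂ hl₂K hG
    calc (l₁.map fun x => ‖x.1 x.2‖).prod * (l₂.map fun x => ‖x.1 x.2‖).prod
        ≤ (l₁.map fun x => ‖x.1 x.2‖).prod *
            (2 ^ (2 * k * 2 ^ k) * (2 ^ (2 * k * 2 ^ k) * (2 ^ (2 * 2 ^ (k + 1)) * B) /
              (l₁.map fun x => ‖x.1 x.2‖).prod)) :=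
          mul_le_mul_of_nonneg_left h₂ hpos.le
      _ = 2 ^ (2 * (k + 1) * 2 ^ (k + 1)) * B := by
          field_simp
          ring

end Roy2013

end Literature.NumberTheory.Transcendental
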